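import Literature.Topology.FourManifolds.InteriorConnected
import Literature.Topology.FourManifolds.InteriorDiscs
import Literature.Topology.FourManifolds.InteriorDiffeoExtension
import Literature.Topology.FourManifolds.Recharted
import Literature.Topology.FourManifolds.DiscTheoremSupport
import HarnessLib

/-!
# The disc theorem for manifolds with arbitrary models (boundary and corners allowed)

Topic `Literature/Topology/FourManifolds` (brick [A7] of the discharge of
`Literature.Topology.FourManifolds.nonempty_diffeomorph_of_isOrientedConnectedSum` at arbitrary
models, see `ConnectedSumUniquenessProofs.lean`).

**Disc theorem** (R. Palais, *Extending diffeomorphisms*, Proc. AMS 11 (1960), Thm. B;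
J. Cerf (1961); M. W. Hirsch, *Differential Topology* (1976), Ch. 8 §3, Thm. 3.1; the form used by
A. Kosinski, *Differential Manifolds* (1993), VI.(1.1), for connected sums of manifolds with
boundary, discs in `Int M`): let `M` be a connected Hausdorff `C^∞` manifold modelled on an
*arbitrary* real model with corners `I : ModelWithCorners ℝ E H` over a finite-dimensional normed
space `E ≠ 0`, `oM` a smooth orientation of `M`, and `i, i' : E → M` two discs (smooth embeddings
of the model vector space) which both preserve the orientations `(o₀, oM)`. Then there is a
diffeomorphism `f` of `M` (for the model `I`) with `f (i y) = i' y` for all `‖y‖ ≤ 1`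
(`Literature.Topology.FourManifolds.exists_diffeomorph_apply_disc_eq_of_model`).

## Proof (reduction to the `ℝⁿ`-modelled case of the tree)

1. The discs lie in the interior and factor through the boundaryless interior manifold
   `X = InteriorManifold I M` (`InteriorDiscs.lean`), which is connected (`InteriorConnected.lean`)
   and oriented by `oM.interior`, the lifts `î, î'` preserving `(o₀, oM.interior)`.
2. Rechart `X` along a linear isomorphism `L : E ≃L[ℝ] ℝⁿ` of operator norm `≤ 1`
   (`Recharted.lean`): `Recharted X L` is an `ℝⁿ`-modelled connected Hausdorff manifold, the
   discs `L∘`-conjugate to discs `j, j' : ℝⁿ → Recharted X L` preserving the transported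
   orientations.
3. The oriented disc theorem with compact support (`exists_diffeomorph_apply_disc_eq_cs`,
   `DiscTheoremSupport.lean`; Hirsch's Thm. 8.3.1 "by a diffeotopy having compact support") gives
   a compactly supported diffeomorphism `g` of `Recharted X L` with `g ∘ j = j'` on the unit ball
   of `ℝⁿ`, which contains the `L`-image of the unit ball of `E`.
4. Read back on `X` (same underlying space) and extend by the identity over `M`
   (`InteriorManifold.exists_diffeomorph_extend`, `InteriorDiffeoExtension.lean`).

Everything is proved; no named facts.

## References

* R. Palais, *Extending diffeomorphisms*, Proc. AMS 11 (1960) 274–277, Thm. B. [Palais1960]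
* M. W. Hirsch, *Differential Topology*, GTM 33 (1976), Ch. 8 §3, Thm. 3.1. [HirschDT1976]
* A. Kosinski, *Differential Manifolds* (1993), Ch. VI §1, Thm (1.1). [Kosinski1993]
-/

open scoped Manifold ContDiff Topology
open Set Module Function Filter

noncomputable section

namespace Literature.Topology.FourManifolds

section Scaling

variable {E E' : Type*} [NormedAddCommGroup E] [NormedSpace ℝ E] [NormedAddCommGroup E']
  [NormedSpace ℝ E']

/-- Rescaling a continuous linear isomorphism to operator norm `≤ 1`: `(‖L‖ + 1)⁻¹ • L`.
[folklore] -/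
def ContinuousLinearEquiv.shrink (L : E ≃L[ℝ] E') : E ≃L[ℝ] E' :=
  L.trans (ContinuousLinearEquiv.equivOfInverse
    ((‖(L : E →L[ℝ] E')‖ + 1)⁻¹ • ContinuousLinearMap.id ℝ E')
    ((‖(L : E →L[ℝ] E')‖ + 1) • ContinuousLinearMap.id ℝ E')
    (fun x => by
      have h : (‖(L : E →L[ℝ] E')‖ + 1) ≠ 0 := by positivity
      simp [smul_smul, inv_mul_cancel₀ h])
    (fun x => by
      have h : (‖(L : E →L[ℝ] E')‖ + 1) ≠ 0 := by positivity
      simp [smul_smul, mul_inv_cancel₀ h]))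

/-- `L.shrink y = (‖L‖ + 1)⁻¹ • L y`. [folklore] -/
@[simp] theorem ContinuousLinearEquiv.shrink_apply (L : E ≃L[ℝ] E') (y : E) :
    ContinuousLinearEquiv.shrink L y = (‖(L : E →L[ℝ] E')‖ + 1)⁻¹ • L y := rfl

/-- The rescaled isomorphism does not increase norms: `‖L.shrink y‖ ≤ ‖y‖`. [folklore] -/
theorem ContinuousLinearEquiv.norm_shrink_le (L : E ≃L[ℝ] E') (y : E) :
    ‖ContinuousLinearEquiv.shrink L y‖ ≤ ‖y‖ := by
  rw [ContinuousLinearEquiv.shrink_apply, norm_smul, Real.norm_of_nonneg (by positivity)]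
  have h1 : ‖L y‖ ≤ ‖(L : E →L[ℝ] E')‖ * ‖y‖ := (L : E →L[ℝ] E').le_opNorm y
  have h2 : 0 < ‖(L : E →L[ℝ] E')‖ + 1 := by positivity
  rw [inv_mul_le_iff₀ h2]
  nlinarith [norm_nonneg y, norm_nonneg (L : E →L[ℝ] E')]

end Scaling

section DiscTheorem

variable {E : Type*} [NormedAddCommGroup E] [NormedSpace ℝ E] [FiniteDimensional ℝ E]
  {H : Type*} [TopologicalSpace H] {I : ModelWithCorners ℝ E H}
  {M : Type*} [TopologicalSpace M] [T2Space M] [ChartedSpace H M] [IsManifold I ∞ M]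

/-- **Disc theorem, arbitrary model with corners** (R. Palais, *Extending diffeomorphisms*
(1960), Thm. B; Hirsch, *Differential Topology* (1976), Ch. 8 §3, Thm. 3.1; the form used in
Kosinski, *Differential Manifolds* (1993), VI.(1.1)): in a connected Hausdorff `C^∞` manifold `M`
modelled on any real model with corners over a finite-dimensional normed space `E ≠ 0`, two
discs `i, i' : E → M` (smooth embeddings of the model vector space) which both preserve the
orientations `(o₀, oM)` agree on the closed unit ball of `E` after a diffeomorphism of `M`:
`f (i y) = i' y` for `‖y‖ ≤ 1`. Proof: interior manifold, recharting on `ℝⁿ`, the compactly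
supported oriented disc theorem of the tree, extension by the identity (module docstring).
[cite: Palais1960, Thm. B] [cite: HirschDT1976, Ch. 8 §3, Thm. 3.1] -/
theorem exists_diffeomorph_apply_disc_eq_of_model [ConnectedSpace M] (hE : finrank ℝ E ≠ 0)
    {i i' : E → M} (hi : Manifold.IsSmoothEmbedding 𝓘(ℝ, E) I ∞ i)
    (hi' : Manifold.IsSmoothEmbedding 𝓘(ℝ, E) I ∞ i')
    {o₀ : Orientation ℝ E (Fin (finrank ℝ E))} {oM : SmoothOrientation I M}
    (ho : IsOrientationPreserving (SmoothOrientation.modelSpace o₀) oM i)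
    (ho' : IsOrientationPreserving (SmoothOrientation.modelSpace o₀) oM i') :
    ∃ f : M ≃ₘ⟮I, I⟯ M, ∀ y : E, ‖y‖ ≤ 1 → f (i y) = i' y := by
  -- Step 1: the interior manifold and the lifted discs
  have hint := isInteriorPoint_of_isSmoothEmbedding_disc hi
  have hint' := isInteriorPoint_of_isSmoothEmbedding_disc hi'
  have hî : Manifold.IsSmoothEmbedding 𝓘(ℝ, E) 𝓘(ℝ, E) ∞ (InteriorManifold.lift i hint) :=
    InteriorManifold.isSmoothEmbedding_lift_disc hi
  have hî' : Manifold.IsSmoothEmbedding 𝓘(ℝ, E) 𝓘(ℝ, E) ∞ (InteriorManifold.lift i' hint') :=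
    InteriorManifold.isSmoothEmbedding_lift_disc hi'
  have hoî : IsOrientationPreserving (SmoothOrientation.modelSpace o₀) oM.interior
      (InteriorManifold.lift i hint) :=
    (isOrientationPreserving_lift_iff hint).2 ho
  have hoî' : IsOrientationPreserving (SmoothOrientation.modelSpace o₀) oM.interior
      (InteriorManifold.lift i' hint') :=
    (isOrientationPreserving_lift_iff hint').2 ho'
  -- Step 2: rechart on `ℝⁿ` along a norm-nonincreasing linear isomorphism
  let L : E ≃L[ℝ] EuclideanSpace ℝ (Fin (finrank ℝ E)) :=
    ContinuousLinearEquiv.shrink (ContinuousLinearEquiv.ofFinrankEq (by simp))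
  have hL1 : ∀ y : E, ‖L y‖ ≤ ‖y‖ := fun y => ContinuousLinearEquiv.norm_shrink_le _ y
  have hjE : Manifold.IsSmoothEmbedding 𝓘(ℝ, EuclideanSpace ℝ (Fin (finrank ℝ E)))
      (𝓡 (finrank ℝ E)) ∞
      (Recharted.of L ∘ InteriorManifold.lift i hint ∘ (L.symm : _ → E) :
        _ → Recharted (InteriorManifold I M) L) :=
    Recharted.isSmoothEmbedding_disc L hî
  have hjE' : Manifold.IsSmoothEmbedding 𝓘(ℝ, EuclideanSpace ℝ (Fin (finrank ℝ E)))
      (𝓡 (finrank ℝ E)) ∞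
      (Recharted.of L ∘ InteriorManifold.lift i' hint' ∘ (L.symm : _ → E) :
        _ → Recharted (InteriorManifold I M) L) :=
    Recharted.isSmoothEmbedding_disc L hî'
  have hoj := (Recharted.isOrientationPreserving_disc_iff L (o₀ := o₀) (o := oM.interior)
    (hî.contMDiff.mdifferentiable (by simp))).2 hoî
  have hoj' := (Recharted.isOrientationPreserving_disc_iff L (o₀ := o₀) (o := oM.interior)
    (hî'.contMDiff.mdifferentiable (by simp))).2 hoî'
  -- Step 3: the compactly supported oriented disc theorem on `Recharted X L`
  obtain ⟨g, -, hgs, hg⟩ := exists_diffeomorph_apply_disc_eq_cs hE hjE hjE' hoj hoj'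
  obtain ⟨K, hK, hgK⟩ := exists_isCompact_forall_eq_self_of_hasCompactFixedSupport hgs
  -- Step 4: read back on `X` and extend by the identity to `M`
  let g' : InteriorManifold I M ≃ₘ⟮𝓘(ℝ, E), 𝓘(ℝ, E)⟯ InteriorManifold I M :=
    (Recharted.diffeomorph L).trans (g.trans (Recharted.diffeomorph L).symm)
  have hg'c : ∀ x : InteriorManifold I M, g' x = (Recharted.of L).symm (g (Recharted.of L x)) :=
    fun x => rfl
  have hK' : IsCompact ((Recharted.of L).symm '' K) :=
    hK.image (Recharted.contMDiff_of_symm L).continuous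
  have hg'K : ∀ x ∉ (Recharted.of L).symm '' K, g' x = x := fun x hx => by
    have hx' : Recharted.of L x ∉ K := fun h => hx ⟨_, h, rfl⟩
    rw [hg'c, hgK _ hx']
    rfl
  obtain ⟨F, hF, -⟩ := InteriorManifold.exists_diffeomorph_extend g' hK' hg'K
  refine ⟨F, fun y hy => ?_⟩
  have h1 : i y = (InteriorManifold.lift i hint y).val := rfl
  have h2 : i' y = (InteriorManifold.lift i' hint' y).val := rfl
  rw [h1, hF, hg'c, h2]
  congr 1
  have h3 : Recharted.of L (InteriorManifold.lift i hint y) =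
      (Recharted.of L ∘ InteriorManifold.lift i hint ∘ (L.symm : _ → E)) (L y) := by
    simp
  rw [h3, hg (L y) ((hL1 y).trans hy)]
  simp

end DiscTheorem

end Literature.Topology.FourManifolds
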